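import Summits.Ventures.HodgeRepro2.T5BergmanU11
import Summits.Ventures.HodgeRepro2.T5BergmanRuhlModel

/-!
# The Cartan decomposition of `U(1,1)` and the lowest-weight coefficient on `H_j = U(1,1)`

`U(1,1) = Z · SU(1,1)` (`T5U11Product.mulHom_surjective`) and `SU(1,1) = K A⁺ K`
(`T5SU11Cartan.exists_cartan`) give **`U(1,1) = Z K A⁺ K`**: every `g ∈ U(1,1)` is
`λ · rot u · a_t · rot v` with `λ, u, v` on the unit circle and `t ≥ 0` (`exists_cartan`).

In these coordinates the lowest-weight matrix coefficient of the weight-`k` model on `U(1,1)`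
(`T5BergmanU11.actU`, central character `λ ↦ λ^k`) is

  `⟨π_k(λ · rot u · a_t · rot v) 1, 1⟩_k = λ^k (uv)^{-k} cosh(t)^{-k} · π/(k-1)`   (`pairing_actU_cartan`),

so for `k = 3`: `coeffU(λ · rot u · a_t · rot v) = λ³ (uv)^{-3} cosh(t)^{-3} · π/2` (`coeffU_cartan`) and
`|coeffU| = (π/2) cosh(t)^{-3}` (`norm_coeffU_cartan`) — the bicovariant form of S4 l. 82's
`|⟨π(g) f, f⟩| = ‖f‖² cosh(η/2)^{-3}` (`η = 2t`) on `H_j = U(1,1)`, with the centre acting by the central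
character only (`coeffU_scalarHom_mul`).

Blind lane: Mathlib + the HodgeRepro2 prefix only; no sorry; axioms ⊆ {propext, Classical.choice,
Quot.sound}.
-/

namespace Summit.Ventures.HodgeRepro2.T5U11Cartan

open T5SU11Unimodular T5U11Unimodular T5U11Product T5SU11Fibration T5SU11Cartan
open T5BergmanCoefficient T5BergmanPairing T5BergmanUnitary T5BergmanCoefficientL2 T5BergmanU11
open T5BergmanRuhlModel
open scoped Real

/-! ### `U(1,1) = Z K A⁺ K` -/

/-- **The Cartan decomposition of `U(1,1)`**: every `g ∈ U(1,1)` is `λ · rot u · a_t · rot v` with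
`λ, u, v ∈ U(1)` and `t ≥ 0`. -/
theorem exists_cartan (g : U11) :
    ∃ (lam u v : Circle) (t : ℝ), 0 ≤ t ∧
      g = scalarHom lam * incl (rot u * hyp t * rot v) := by
  obtain ⟨⟨lam, h⟩, hg⟩ := mulHom_surjective g
  obtain ⟨u, v, t, ht, hh⟩ := T5SU11Cartan.exists_cartan h
  refine ⟨lam, u, v, t, ht, ?_⟩
  rw [← hg, hh]
  exact mulHom_apply (lam, rot u * hyp t * rot v)

/-- The same, through `mulHom`. -/
theorem exists_cartan' (g : U11) :
    ∃ (lam u v : Circle) (t : ℝ), 0 ≤ t ∧ g = mulHom (lam, rot u * hyp t * rot v) := by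
  obtain ⟨lam, u, v, t, ht, hg⟩ := exists_cartan g
  exact ⟨lam, u, v, t, ht, hg.trans (mulHom_apply (lam, rot u * hyp t * rot v)).symm⟩

/-! ### The centre acts by the central character -/

/-- `⟨π_k(λ g) f, f'⟩_k = λ^k ⟨π_k(g) f, f'⟩_k` on `U(1,1)`: the centre acts through the central
character `λ ↦ λ^k`. -/
theorem pairing_actU_scalarHom_mul (k : ℕ) (lam : Circle) (g : U11) (f f' : ℂ → ℂ) :
    pairing k (actU k (scalarHom lam * g) f) f' = (lam : ℂ) ^ k * pairing k (actU k g f) f' := by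
  obtain ⟨⟨mu, h⟩, rfl⟩ := mulHom_surjective g
  have e1 : scalarHom lam * mulHom (mu, h) = mulHom (lam * mu, h) := by
    rw [mulHom_apply, mulHom_apply, map_mul, mul_assoc]
  rw [e1, ← pairing_smul_left]
  apply pairing_congr _ (fun z _ => rfl)
  intro z _
  rw [actU_mulHom, actU_mulHom]
  push_cast
  ring

/-- `coeffU(λ g) = λ³ coeffU g`. -/
theorem coeffU_scalarHom_mul (lam : Circle) (g : U11) :
    coeffU (scalarHom lam * g) = (lam : ℂ) ^ 3 * coeffU g := by
  unfold coeffU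
  exact pairing_actU_scalarHom_mul 3 lam g lowest lowest

/-! ### The lowest-weight coefficient in Cartan coordinates -/

/-- **The lowest-weight matrix coefficient of the weight-`k` model on `U(1,1)` in Cartan coordinates**:
`⟨π_k(λ · rot u · a_t · rot v) 1, 1⟩_k = λ^k (uv)^{-k} cosh(t)^{-k} · π/(k-1)` for every `k ≥ 2`. -/
theorem pairing_actU_cartan (k : ℕ) (hk : 2 ≤ k) (lam u v : Circle) (t : ℝ) :
    pairing k (actU k (scalarHom lam * incl (rot u * hyp t * rot v)) lowest) lowest =
      (lam : ℂ) ^ k * (((u : ℂ) * v)⁻¹ ^ k * ((Real.cosh t : ℂ)⁻¹ ^ k * ((π / ((k : ℝ) - 1) : ℝ) : ℂ))) := by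
  rw [show scalarHom lam * incl (rot u * hyp t * rot v) = mulHom (lam, rot u * hyp t * rot v) from
    (mulHom_apply (lam, rot u * hyp t * rot v)).symm]
  have e : ∀ z ∈ Metric.ball (0 : ℂ) 1,
      actU k (mulHom (lam, rot u * hyp t * rot v)) lowest z =
        (lam : ℂ) ^ k * act k (rot u * hyp t * rot v) lowest z := fun z _ => actU_mulHom k lam _ lowest z
  rw [pairing_congr e (fun z _ => rfl), pairing_smul_left, pairing_act_lowest_eq k hk,
    mat_rot_mul_hyp_mul_rot]
  simp only [T5PoincareDensity.su11, Matrix.of_apply, Matrix.cons_val', Matrix.cons_val_zero,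
    Matrix.cons_val_fin_one, Matrix.empty_val']
  rw [mul_inv, mul_pow, mul_assoc]

/-- **`coeffU` in Cartan coordinates**: `⟨π₃(λ · rot u · a_t · rot v) 1, 1⟩₃ = λ³ (uv)^{-3} cosh(t)^{-3} π/2`. -/
theorem coeffU_cartan (lam u v : Circle) (t : ℝ) :
    coeffU (scalarHom lam * incl (rot u * hyp t * rot v)) =
      (lam : ℂ) ^ 3 * (((u : ℂ) * v)⁻¹ ^ 3 * ((Real.cosh t : ℂ)⁻¹ ^ 3 * ((π / 2 : ℝ) : ℂ))) := by
  unfold coeffU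
  rw [pairing_actU_cartan 3 (by norm_num) lam u v t]
  norm_num

/-- **`|coeffU| = (π/2) cosh(t)^{-3}`** on `H_j = U(1,1)` — S4 l. 82's `‖f‖² cosh(η/2)^{-3}` with `η = 2t`,
independent of the centre and of the `K`-components. -/
theorem norm_coeffU_cartan (lam u v : Circle) (t : ℝ) :
    ‖coeffU (scalarHom lam * incl (rot u * hyp t * rot v))‖ = (π / 2) * (Real.cosh t)⁻¹ ^ 3 := by
  rw [coeffU_cartan]
  simp only [norm_mul, norm_pow, norm_inv, Circle.norm_coe, Complex.norm_real, Real.norm_eq_abs,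
    abs_of_pos (Real.cosh_pos t), abs_of_pos (by positivity : (0 : ℝ) < π / 2)]
  ring

/-- The `η`-form: with `η = 2t`, `|coeffU| = (π/2) cosh(η/2)^{-3}` (S4 l. 82 verbatim on `U(1,1)`). -/
theorem norm_coeffU_cartan_eta (lam u v : Circle) (η : ℝ) :
    ‖coeffU (scalarHom lam * incl (rot u * hyp (η / 2) * rot v))‖ = (π / 2) * (Real.cosh (η / 2))⁻¹ ^ 3 :=
  norm_coeffU_cartan lam u v (η / 2)

end Summit.Ventures.HodgeRepro2.T5U11Cartan
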